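import Literature.NumberTheory.GaloisRepresentations.GaloisRep
import Literature.RepresentationTheory.Semisimple.BurnsideMatrixSpan
import Mathlib.NumberTheory.Padics.Complex
import Mathlib.Analysis.SpecificLimits.Basic
import HarnessLib

/-!
# An irreducible `p`-adic Galois representation whose trace is a uniform limit of traces unramified
# at `v` is unramified at `v`

Topic `Literature/NumberTheory/GaloisRepresentations`; a proofs file (one theorem, no definitions).

For a number field `K`, a finite place `v`, and a continuous `ρ : Γ_K → GL_n(ℚ̄_p)`
(`FramedGaloisRep K (PadicAlgCl p) n`) which is irreducible (hence absolutely irreducible, `ℚ̄_p` being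
algebraically closed): if for every `m` there is a continuous `r' : Γ_K → GL_n(ℚ̄_p)` UNRAMIFIED at `v`
with `‖tr r'(g) − tr ρ(g)‖ ≤ p^{-m}` for all `g ∈ Γ_K`, then `ρ` is unramified at `v`.  Proof: for `σ`
in an inertia group above `v`, `tr ρ(gσ) = tr ρ(g)` for all `g` (uniform limit of the same identity for
the `r'`), i.e. `tr(ρ(g)(ρ(σ) − 1)) = 0`; by Burnside (`span_eq_top_of_isIrreducible`) the `ρ(g)` span
`M_n(ℚ̄_p)`, so `tr(A(ρ(σ) − 1)) = 0` for every matrix `A` and `ρ(σ) = 1`.  This is the "level" half of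
the standard remark that a `p`-adic limit of automorphic Galois representations of bounded tame level has
bounded tame level (e.g. in `p`-adic families of automorphic forms; Chenevier, *Familles p-adiques de
formes automorphes pour GL_n*, J. reine angew. Math. 570 (2004), §7; Bellaïche–Chenevier 2009 §7.5); here
extracted from the evidence file of stub `stub_weightTwoClassicality` of crux stmt-Langlands-13639
(route `Langlands/PhantomRMYoshida`, line `endoscopic-crossing-euler`).

* `Literature.NumberTheory.GaloisRepresentations.FramedGaloisRep.isUnramifiedAt_of_trace_limit`.
-/

noncomputable section

namespace Literature.NumberTheory.GaloisRepresentations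

/-- **An irreducible `ρ : Γ_K → GL_n(ℚ̄_p)` whose trace is a uniform `p`-adic limit of traces of
representations unramified at `v` is unramified at `v`.**  For `σ` in an inertia group above `v`,
`tr ρ(gσ) = tr ρ(g)` for all `g` (uniform limit), i.e. `tr(ρ(g)(ρ(σ) − 1)) = 0`, and the `ρ(g)` span
`M_n(ℚ̄_p)` (Burnside, `span_eq_top_of_isIrreducible`, `ℚ̄_p` algebraically closed), so `ρ(σ) = 1`.
[folklore] -/
theorem FramedGaloisRep.isUnramifiedAt_of_trace_limit {K : Type} [Field K] [NumberField K] {p : ℕ}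
    [Fact p.Prime] {n : ℕ} (v : IsDedekindDomain.HeightOneSpectrum (NumberField.RingOfIntegers K))
    (ρ : FramedGaloisRep K (PadicAlgCl p) n) (hirr : ρ.toGaloisRep.IsIrreducible)
    (h : ∀ m : ℕ, ∃ r' : FramedGaloisRep K (PadicAlgCl p) n,
      r'.IsUnramifiedAt v ∧ ∀ g, ‖(r' g).val.trace - (ρ g).val.trace‖ ≤ (p : ℝ) ^ (-(m : ℤ))) :
    ρ.IsUnramifiedAt v := by
  intro 𝔓 h𝔓 σ hσ
  -- Step 1: `tr ρ(gσ) = tr ρ(g)` for all `g`.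
  have hlim : Filter.Tendsto (fun m : ℕ => ((p : ℝ)⁻¹) ^ m) Filter.atTop (nhds 0) :=
    tendsto_pow_atTop_nhds_zero_of_lt_one (inv_nonneg.mpr (Nat.cast_nonneg p))
      (inv_lt_one_of_one_lt₀ (by exact_mod_cast (Fact.out : p.Prime).one_lt))
  have htr : ∀ g, (ρ (g * σ)).val.trace = (ρ g).val.trace := by
    intro g
    rw [← sub_eq_zero, ← norm_le_zero_iff]
    refine ge_of_tendsto' hlim fun m => ?_
    obtain ⟨r', hur, hcl⟩ := h m
    have h1 : r' (g * σ) = r' g := by rw [map_mul, hur 𝔓 h𝔓 σ hσ, mul_one]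
    have e : (ρ (g * σ)).val.trace - (ρ g).val.trace =
        ((r' g).val.trace - (ρ g).val.trace) +
          -((r' (g * σ)).val.trace - (ρ (g * σ)).val.trace) := by
      rw [h1]; ring
    rw [e]
    calc ‖((r' g).val.trace - (ρ g).val.trace) +
            -((r' (g * σ)).val.trace - (ρ (g * σ)).val.trace)‖
        ≤ max ‖(r' g).val.trace - (ρ g).val.trace‖
            ‖-((r' (g * σ)).val.trace - (ρ (g * σ)).val.trace)‖ :=
          IsUltrametricDist.norm_add_le_max _ _
      _ ≤ (p : ℝ) ^ (-(m : ℤ)) := max_le (hcl _) (by rw [norm_neg]; exact hcl _)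
      _ = ((p : ℝ)⁻¹) ^ m := by rw [zpow_neg, zpow_natCast, inv_pow]
  -- Step 2: `tr (ρ(g) X) = 0` with `X = ρ(σ) - 1`, for all `g`, hence for all matrices (Burnside).
  have hX : ∀ g, (((ρ g : GL (Fin n) (PadicAlgCl p)) : Matrix (Fin n) (Fin n) (PadicAlgCl p)) *
      ((((ρ σ : GL (Fin n) (PadicAlgCl p)) : Matrix (Fin n) (Fin n) (PadicAlgCl p))) - 1)).trace = 0 := by
    intro g
    rw [mul_sub, mul_one, ← Units.val_mul, ← map_mul, Matrix.trace_sub, htr, sub_self]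
  have hspan := Literature.RepresentationTheory.Semisimple.span_eq_top_of_isIrreducible
    (k := PadicAlgCl p) (ρ : Field.absoluteGaloisGroup K →* GL (Fin n) (PadicAlgCl p)) (hirr := hirr)
  have hall : ∀ A : Matrix (Fin n) (Fin n) (PadicAlgCl p),
      (A * ((((ρ σ : GL (Fin n) (PadicAlgCl p)) : Matrix (Fin n) (Fin n) (PadicAlgCl p))) - 1)).trace
        = 0 := by
    intro A
    have hA : A ∈ Submodule.span (PadicAlgCl p)
        (Set.range fun g => (((ρ : Field.absoluteGaloisGroup K →* GL (Fin n) (PadicAlgCl p)) g :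
          GL (Fin n) (PadicAlgCl p)) : Matrix (Fin n) (Fin n) (PadicAlgCl p))) := by
      rw [hspan]; exact Submodule.mem_top
    refine Submodule.span_induction ?_ ?_ ?_ ?_ hA
    · rintro _ ⟨g, rfl⟩; exact hX g
    · rw [zero_mul, Matrix.trace_zero]
    · intro x y _ _ hx hy; rw [add_mul, Matrix.trace_add, hx, hy, add_zero]
    · intro c x _ hx; rw [smul_mul_assoc, Matrix.trace_smul, hx, smul_zero]
  have hmat : ((((ρ σ : GL (Fin n) (PadicAlgCl p)) : Matrix (Fin n) (Fin n) (PadicAlgCl p))) - 1) = 0 :=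
    Matrix.ext_iff_trace_mul_left.mpr fun x => by rw [hall, mul_zero, Matrix.trace_zero]
  exact Units.ext (sub_eq_zero.mp hmat)

end Literature.NumberTheory.GaloisRepresentations
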